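import Mathlib
import HarnessLib
import Summits.Langlands.Langlands.Theses.QuarterDeficit1951
import Literature.NumberTheory.Automorphic.GL2RSLFactorCharacter
import Literature.NumberTheory.Automorphic.GL2SphericalOfLFactorDegreeTwo
import Literature.NumberTheory.Automorphic.TateLocalFactors
import Literature.NumberTheory.Automorphic.LocalComponentBJGenericProofs
import Literature.NumberTheory.Automorphic.NewformAdelisationHeckeLocal
import Literature.NumberTheory.Automorphic.WhittakerCoeffLocalDatum
import Literature.NumberTheory.Automorphic.GL2NewvectorUpToTwist
import Literature.NumberTheory.GaloisRepresentations.HeckeCharacterProofs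
import Summits.Langlands.Langlands.Theorems.QuarterDeficit1951CorrespondentFingerprintStubLocal1951Galois
import Summits.Langlands.Langlands.Theorems.QuarterDeficit1951CorrespondentFingerprintStubLocal1951LLC
import Summits.Langlands.Langlands.Theorems.QuarterDeficit1951CorrespondentFingerprintStubLocal1951RepTheory

/-!
# `stub_levelOne_local1951` (crux stmt-Langlands-15898, line `Sketch`) from its three landed pieces

The registered stub `stub_levelOne_local1951` — a non-zero `K₁(1951)_v`-fixed vector in an irreducible
smooth local component of the correspondent at `q_v = 1951` — assembled from the landed sub-goals
`stub_local1951_galois` (C1, Galois side), `stub_local1951_llc` (C2, LLC bookkeeping) and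
`stub_local1951_reptheory` (C3, local representation theory): local–global compatibility at `v ∤ ℓ`,
genericity of the cuspidal local component, and the translation of the `K₁(𝔭)` conditions into
`IsLocK1 v (1951)`.  (Composition written by the line's levelOne worker; checked rc 0 modulo C1–C3.)
-/

set_option linter.dupNamespace false -- project-wide option (lakefile weak.linter.dupNamespace); `Summit.Langlands.Langlands` is the mandated namespace

noncomputable section

open scoped MatrixGroups Matrix NumberField Classical Polynomial
open Literature.NumberTheory.Automorphic Literature.NumberTheory.GaloisRepresentations
  IsDedekindDomain NumberField Polynomial MeasureTheory
open Literature.NumberTheory.GaloisRepresentations.IsNonarchimedeanLocalField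
open Field ValuativeRel
open Summit.Langlands Rat.HeightOneSpectrum

namespace Summit.Langlands.Langlands.Theorems.CorrespondentFingerprint

/-- **Registered stub `stub_levelOne_local1951`, PROVED from (C1), (C2), (C3).**  Glue: `v ∤ ℓ`
(`q_v = 1951 ≠ ℓ`), the local–global clause at `v` (`Corresponds.2 v`), genericity of the cuspidal
local component (`exists_isGeneric_of_hasLocalComponentAt`), and the translation of the `K₁(𝔭)`
conditions `k ∈ GL₂(𝒪)`, `|k₂₁| < 1`, `|k₂₂ - 1| < 1` into `IsLocK1 v (1951)`
(`glInt_adicCompletion_eq`, `normAbs_lt_one_iff`, `valuation_adicCompletion_lt_one_iff`,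
`Rat.idealRadius_span_natCast_eq`). [cite: Casselman1973, Thm. 1] [cite: HarrisTaylorAMS2001, Thm. A] -/
theorem stub_levelOne_local1951 : ∀ (RD : Summit.Langlands.ReciprocityData ℚ) (ℓ : ℕ) [Fact ℓ.Prime]
    (ι : PadicAlgCl ℓ ≃+* ℂ) (hcpt : isCompact_glFiniteIntegralLevel 2 ℚ)
    (π : CuspidalAutomorphicRepData 2 ℚ hcpt) (ρ : FramedGaloisRep ℚ (PadicAlgCl ℓ) 2),
    17 ≤ ℓ → ℓ ≠ 1951 →
    (ρ.toGaloisRep.IsIrreducible ∧ (Set.range ρ).Finite ∧ ρ.IsEven ∧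
      ρ.toGaloisRep.artinConductorNat = 1951 ∧
      ∃ χ₀ : DirichletCharacter ℂ 1951, orderOf χ₀ = 5 ∧
        ∀ v : HeightOneSpectrum (𝓞 ℚ), v.residueCard ≠ 1951 →
          ρ.IsUnramifiedAt v ∧ ∃ t d : PadicAlgCl ℓ,
            ρ.HasFrobCharpolyAt v (X ^ 2 - C t * X + C d) ∧
            ι d = (χ₀ (v.residueCard : ZMod 1951))⁻¹ ∧
            (t ^ 2 = 0 ∨ t ^ 2 = d ∨ t ^ 2 = 4 * d ∨ t ^ 4 - 3 * d * t ^ 2 + d ^ 2 = 0)) →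
    Summit.Langlands.Corresponds RD ι π.1 ρ →
    ∀ v : HeightOneSpectrum (𝓞 ℚ), v.residueCard = 1951 →
      ∃ (πv : SmoothIrrep (GL (Fin 2) (v.adicCompletion ℚ))) (x₀ : πv.V),
        π.1.HasLocalComponentAt v πv.ρ ∧ x₀ ≠ 0 ∧
          ∀ m : GL (Fin 2) (v.adicCompletion ℚ), IsLocK1 v (Ideal.span {(1951 : 𝓞 ℚ)}) m →
            πv.ρ m x₀ = x₀ := by
  intro RD ℓ _ ι hcpt π ρ _ hℓ' hyp hcorr v hv
  classical
  obtain ⟨-, hfin, -, hcond, χ₀, -, hχ₀⟩ := hyp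
  have hunr : ∀ w : HeightOneSpectrum (𝓞 ℚ), w.residueCard ≠ 1951 → ρ.IsUnramifiedAt w :=
    fun w hw => (hχ₀ w hw).1
  have hp : Nat.Prime 1951 := by norm_num
  have hvgen : natGenerator v = 1951 := by rw [← Rat.residueCard_eq_natGenerator]; exact hv
  -- `v ∤ ℓ`
  have hvℓ : ((ℓ : ℕ) : 𝓞 ℚ) ∉ v.asIdeal := by
    intro h
    have h1 : natGenerator v ∣ ℓ := (Rat.natCast_mem_asIdeal_iff v).1 h
    rw [hvgen] at h1
    exact hℓ' ((Nat.prime_dvd_prime_iff_eq hp Fact.out).1 h1).symm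
  -- local–global compatibility at `v`, (C1), genericity, (C2), (C3)
  obtain ⟨πv, rv, rℂ, hloc, hWD, -, hTr, hcl⟩ := hcorr.2 v
  obtain ⟨hproP, hgal⟩ := stub_local1951_galois ℓ ι ρ hfin hcond hunr v hv
  obtain ⟨r', hr', hq, hN, hshape⟩ := hgal rv rℂ _ (hWD hvℓ) hTr hcl
  haveI := πv.isIrreducible
  obtain ⟨ψ, hψ, hgen⟩ := π.exists_isGeneric_of_hasLocalComponentAt v πv.ρ πv.isSmooth hloc
  obtain ⟨χ, hχ1, hχ0, hL1, hLχ⟩ :=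
    stub_local1951_llc (v.adicCompletion ℚ) hproP (RD.llc v) πv ψ hψ hgen r' hr' hq.symm hN hshape
  haveI : CharZero (v.adicCompletion ℚ) :=
    charZero_of_injective_algebraMap (algebraMap ℚ (v.adicCompletion ℚ)).injective
  obtain ⟨x₀, hx₀, hfix⟩ := stub_local1951_reptheory (v.adicCompletion ℚ) πv ψ hψ hgen χ hχ1 hχ0
    (fun ν _ _ _ => hL1 ν) (fun ν _ _ _ => hLχ ν)
  -- the `IsLocK1 v (1951)` conditions imply the `K₁(𝔭)` conditions
  have hrad : idealRadius ℚ v (Ideal.span {(1951 : 𝓞 ℚ)}) = WithZero.exp (-1 : ℤ) := by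
    have h1 := Rat.idealRadius_span_natCast_eq v (M := 1951) (by norm_num)
    rw [hvgen, Nat.Prime.factorization_self hp] at h1
    simpa using h1
  have hlt : ∀ x : v.adicCompletion ℚ, Valued.v x ≤ idealRadius ℚ v (Ideal.span {(1951 : 𝓞 ℚ)}) →
      normAbs (v.adicCompletion ℚ) x < 1 := by
    intro x hx
    rw [normAbs_lt_one_iff, valuation_adicCompletion_lt_one_iff]
    rw [hrad] at hx
    calc Valued.v x ≤ WithZero.exp (-1 : ℤ) := hx
      _ < WithZero.exp (0 : ℤ) := WithZero.exp_lt_exp.2 (by norm_num)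
      _ = 1 := WithZero.exp_zero
  refine ⟨πv, x₀, hloc, hx₀, fun m hm => hfix m ?_ (hlt _ hm.2.2.1) (hlt _ hm.2.2.2.2)⟩
  rw [glInt_adicCompletion_eq]
  exact hm.mem_valuedCongruenceSubgroup_one

end Summit.Langlands.Langlands.Theorems.CorrespondentFingerprint

end
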